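import Summits.KontsevichZagierPeriods.KontsevichZagierPeriods.Theorems.K2SymbolChainsJensenIsScissorsAlgebra
import Summits.KontsevichZagierPeriods.KontsevichZagierPeriods.Theorems.K2SymbolChainsJensenIsScissorsDilation
import Summits.KontsevichZagierPeriods.KontsevichZagierPeriods.Theorems.K2SymbolChainsJensenIsScissorsMeasure

/-!
# Jensen is scissors — the Möbius rotation as a function on the base: semialgebraicity,
# differentiability, and the null pole set

Support file for item stmt-KontsevichZagierPeriods-5204 (`JensenIsScissors`, route
KontsevichZagierPeriods/K2SymbolChains). Over a base point `x ∈ B ⊆ ℝⁿ` with centre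
`α(x) = α₁(x) + iα₂(x) ≠ 0`, `ρ = |α|`, the rotation of the rational circle coordinate is
`s ↦ P/Q`, `P = α₂ s² + 2α₁ s − α₂`, `Q = (ρ − α₁) s² + 2α₂ s + (ρ + α₁)` (`Algebra` file). Here we
treat `P`, `Q`, `P/Q` as functions of `b = (x, s) ∈ ℝⁿ⁺¹`: quadratics in the last coordinate with
`ℚ`-semialgebraic (resp. differentiable) coefficients are `ℚ`-semialgebraic (resp. differentiable),
their quotient has the expected derivative along `s`, `ρ = √(α₁² + α₂²)` is `ℚ`-semialgebraic and
differentiable where `α` is and `α ≠ 0`, and the pole set `{Q = 0}` meets each fibre in at most one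
point, hence is Lebesgue-null. [Bochnak–Coste–Roy 1998, §2.2] [folklore]
-/

noncomputable section

open MeasureTheory Set
open Literature.NumberTheory.Transcendental Literature.ModelTheory.ExponentialFields

namespace Summit.KontsevichZagierPeriods.K2SymbolChains.JensenIsScissorsProof

open Literature.NumberTheory.Transcendental.KZ

variable {n : ℕ}

/-! ### Quadratics in the last coordinate -/

/-- A quadratic in the last coordinate with `ℚ`-semialgebraic coefficients (functions of the base
point) is `ℚ`-semialgebraic on any `ℚ`-semialgebraic set over the base. [BCR 1998, Prop. 2.2.6]
[folklore] -/
theorem isSemialgebraicFunOn_quad {B : Set (Fin n → ℝ)} {c₀ c₁ c₂ : (Fin n → ℝ) → ℝ}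
    (hc₀ : IsSemialgebraicFunOn ℚ B c₀) (hc₁ : IsSemialgebraicFunOn ℚ B c₁) (hc₂ : IsSemialgebraicFunOn ℚ B c₂)
    {D : Set (Fin (n + 1) → ℝ)} (hD : IsSemialgebraic ℚ D) (hDB : D ⊆ {b | Fin.init b ∈ B}) :
    IsSemialgebraicFunOn ℚ D (fun b => c₂ (Fin.init b) * b (Fin.last n) ^ 2 +
      c₁ (Fin.init b) * b (Fin.last n) + c₀ (Fin.init b)) := by
  have hs := isSemialgebraicFunOn_apply hD (Fin.last n)
  have h₀ := hc₀.comp_init.mono hDB hD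
  have h₁ := hc₁.comp_init.mono hDB hD
  have h₂ := hc₂.comp_init.mono hDB hD
  exact IsSemialgebraicFunOn.add_holds (IsSemialgebraicFunOn.add_holds
    (IsSemialgebraicFunOn.mul_holds h₂ (IsSemialgebraicFunOn.mul_holds hs hs))
    (IsSemialgebraicFunOn.mul_holds h₁ hs)) h₀ |>.congr fun b _ => by simp only [Pi.add_apply, Pi.mul_apply]; ring

/-- A quadratic in the last coordinate with coefficients differentiable at the base point is
differentiable. [folklore] -/
theorem differentiableAt_quad {c₀ c₁ c₂ : (Fin n → ℝ) → ℝ} {b : Fin (n + 1) → ℝ}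
    (hc₀ : DifferentiableAt ℝ c₀ (Fin.init b)) (hc₁ : DifferentiableAt ℝ c₁ (Fin.init b))
    (hc₂ : DifferentiableAt ℝ c₂ (Fin.init b)) :
    DifferentiableAt ℝ (fun b : Fin (n + 1) → ℝ => c₂ (Fin.init b) * b (Fin.last n) ^ 2 +
      c₁ (Fin.init b) * b (Fin.last n) + c₀ (Fin.init b)) b := by
  have hi : DifferentiableAt ℝ (fun w : Fin (n + 1) → ℝ => Fin.init w) b :=
    (ContinuousLinearMap.pi fun j => ContinuousLinearMap.proj (R := ℝ)
      (φ := fun _ : Fin (n + 1) => ℝ) (Fin.castSucc j)).differentiableAt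
  have hs : DifferentiableAt ℝ (fun w : Fin (n + 1) → ℝ => w (Fin.last n)) b :=
    differentiableAt_apply (Fin.last n) b
  exact (((hc₂.comp b hi).mul (hs.pow 2)).add ((hc₁.comp b hi).mul hs)).add (hc₀.comp b hi)

/-- The derivative of a quotient of two one-variable quadratics. [folklore] -/
theorem hasDerivAt_quad_div {c₀ c₁ c₂ d₀ d₁ d₂ t : ℝ} (hQ : d₂ * t ^ 2 + d₁ * t + d₀ ≠ 0) :
    HasDerivAt (fun t : ℝ => (c₂ * t ^ 2 + c₁ * t + c₀) / (d₂ * t ^ 2 + d₁ * t + d₀))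
      (((2 * c₂ * t + c₁) * (d₂ * t ^ 2 + d₁ * t + d₀) - (c₂ * t ^ 2 + c₁ * t + c₀) * (2 * d₂ * t + d₁)) /
        (d₂ * t ^ 2 + d₁ * t + d₀) ^ 2) t := by
  have h1 : HasDerivAt (fun t : ℝ => t ^ 2) (2 * t) t := by simpa using hasDerivAt_pow 2 t
  have hP : HasDerivAt (fun t : ℝ => c₂ * t ^ 2 + c₁ * t + c₀) (2 * c₂ * t + c₁) t := by
    have h := ((h1.const_mul c₂).add ((hasDerivAt_id' t).const_mul c₁)).add_const c₀
    exact h.congr_deriv (by ring)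
  have hQ' : HasDerivAt (fun t : ℝ => d₂ * t ^ 2 + d₁ * t + d₀) (2 * d₂ * t + d₁) t := by
    have h := ((h1.const_mul d₂).add ((hasDerivAt_id' t).const_mul d₁)).add_const d₀
    exact h.congr_deriv (by ring)
  exact hP.div hQ' hQ

/-! ### The modulus `ρ = √(α₁² + α₂²)` -/

/-- `ρ` is `ℚ`-semialgebraic on `B` when `α₁, α₂` are. [BCR 1998, Prop. 2.2.6] [folklore] -/
theorem isSemialgebraicFunOn_modulus {B : Set (Fin n → ℝ)} {α₁ α₂ : (Fin n → ℝ) → ℝ}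
    (hα₁ : IsSemialgebraicFunOn ℚ B α₁) (hα₂ : IsSemialgebraicFunOn ℚ B α₂) :
    IsSemialgebraicFunOn ℚ B (fun x => Real.sqrt (α₁ x ^ 2 + α₂ x ^ 2)) :=
  IsSemialgebraicFunOn.sqrt_holds ((IsSemialgebraicFunOn.add_holds (IsSemialgebraicFunOn.mul_holds hα₁ hα₁)
    (IsSemialgebraicFunOn.mul_holds hα₂ hα₂)).congr fun x _ => by simp only [Pi.add_apply, Pi.mul_apply]; ring)

/-- `ρ` is differentiable where `α₁, α₂` are and `α ≠ 0`. [folklore] -/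
theorem differentiableAt_modulus {α₁ α₂ : (Fin n → ℝ) → ℝ} {x : Fin n → ℝ}
    (h₁ : DifferentiableAt ℝ α₁ x) (h₂ : DifferentiableAt ℝ α₂ x) (hne : α₁ x ^ 2 + α₂ x ^ 2 ≠ 0) :
    DifferentiableAt ℝ (fun x => Real.sqrt (α₁ x ^ 2 + α₂ x ^ 2)) x :=
  ((h₁.pow 2).add (h₂.pow 2)).sqrt hne

/-- `ρ² = α₁² + α₂²` and `ρ > 0` when `α ≠ 0`. [folklore] -/
theorem modulus_sq_pos {a₁ a₂ : ℝ} (hne : a₁ ^ 2 + a₂ ^ 2 ≠ 0) :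
    Real.sqrt (a₁ ^ 2 + a₂ ^ 2) ^ 2 = a₁ ^ 2 + a₂ ^ 2 ∧ 0 < Real.sqrt (a₁ ^ 2 + a₂ ^ 2) := by
  have h0 : 0 ≤ a₁ ^ 2 + a₂ ^ 2 := by positivity
  exact ⟨Real.sq_sqrt h0, Real.sqrt_pos.2 (h0.lt_of_ne (Ne.symm hne))⟩

/-! ### The pole set of the rotation is null -/

/-- The pole set `{(x, s) | x ∈ B, Q(x, s) = 0}` of the rotation meets every fibre in at most one
point, hence is null. [folklore] -/
theorem volume_rot_poles_eq_zero {B : Set (Fin n → ℝ)} {α₁ α₂ : (Fin n → ℝ) → ℝ}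
    (hB : IsSemialgebraic ℚ B) (hα₁ : IsSemialgebraicFunOn ℚ B α₁) (hα₂ : IsSemialgebraicFunOn ℚ B α₂)
    (hne : ∀ x ∈ B, α₁ x ^ 2 + α₂ x ^ 2 ≠ 0) :
    volume {b : Fin (n + 1) → ℝ | Fin.init b ∈ B ∧
      (Real.sqrt (α₁ (Fin.init b) ^ 2 + α₂ (Fin.init b) ^ 2) - α₁ (Fin.init b)) * b (Fin.last n) ^ 2 +
        2 * α₂ (Fin.init b) * b (Fin.last n) +
        (Real.sqrt (α₁ (Fin.init b) ^ 2 + α₂ (Fin.init b) ^ 2) + α₁ (Fin.init b)) = 0} = 0 := by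
  have hT : IsSemialgebraic ℚ {b : Fin (n + 1) → ℝ | Fin.init b ∈ B} := isSemialgebraic_cyl hB
  have hρ := isSemialgebraicFunOn_modulus hα₁ hα₂
  have hQ : IsSemialgebraicFunOn ℚ {b : Fin (n + 1) → ℝ | Fin.init b ∈ B} (fun b =>
      (Real.sqrt (α₁ (Fin.init b) ^ 2 + α₂ (Fin.init b) ^ 2) - α₁ (Fin.init b)) * b (Fin.last n) ^ 2 +
        2 * α₂ (Fin.init b) * b (Fin.last n) +
        (Real.sqrt (α₁ (Fin.init b) ^ 2 + α₂ (Fin.init b) ^ 2) + α₁ (Fin.init b))) := by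
    refine (isSemialgebraicFunOn_quad (c₀ := fun x => Real.sqrt (α₁ x ^ 2 + α₂ x ^ 2) + α₁ x)
      (c₁ := fun x => 2 * α₂ x) (c₂ := fun x => Real.sqrt (α₁ x ^ 2 + α₂ x ^ 2) - α₁ x)
      (IsSemialgebraicFunOn.add_holds hρ hα₁)
      ((IsSemialgebraicFunOn.mul_holds (isSemialgebraicFunOn_ratCast hB 2) hα₂).congr fun x _ => by simp)
      (IsSemialgebraicFunOn.sub_holds hρ hα₁) hT subset_rfl).congr fun b _ => ?_
    simp
  refine volume_eq_zero_of_fibre_finite hQ.isSemialgebraic_sep_eq_zero fun x => ?_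
  by_cases hx : x ∈ B
  · obtain ⟨hρ2, hρ0⟩ := modulus_sq_pos (hne x hx)
    refine (Set.finite_singleton (-α₂ x / (Real.sqrt (α₁ x ^ 2 + α₂ x ^ 2) - α₁ x))).subset ?_
    intro t ht
    simp only [mem_setOf_eq, Fin.init_snoc, Fin.snoc_last] at ht
    exact rot_den_eq_zero_subset _ _ _ hρ2 hρ0 ht.2
  · convert Set.finite_empty
    ext t
    simp [hx]

/-! ### Scalar consequences: composition with the inverse rotation, derivative, weight -/

/-- `1 + m² = 2ρ(1 + s²)/Q` for `m = P/Q`. [folklore] -/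
theorem rot_one_add_sq {ρ α₁ α₂ s : ℝ} (hρ : ρ ^ 2 = α₁ ^ 2 + α₂ ^ 2)
    (hQ : (ρ - α₁) * s ^ 2 + 2 * α₂ * s + (ρ + α₁) ≠ 0) :
    1 + ((α₂ * s ^ 2 + 2 * α₁ * s - α₂) / ((ρ - α₁) * s ^ 2 + 2 * α₂ * s + (ρ + α₁))) ^ 2 =
      2 * ρ * (1 + s ^ 2) / ((ρ - α₁) * s ^ 2 + 2 * α₂ * s + (ρ + α₁)) := by
  have hK := rot_sq_add_sq ρ α₁ α₂ s hρ
  set P := α₂ * s ^ 2 + 2 * α₁ * s - α₂ with hP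
  set Q := (ρ - α₁) * s ^ 2 + 2 * α₂ * s + (ρ + α₁) with hQ_def
  field_simp
  linear_combination hK

/-- The weight `ds/(1 + s²)` is preserved: `(c/(1 + m²)) · (2ρ/Q) = c/(1 + s²)`. [folklore] -/
theorem rot_weight {ρ α₁ α₂ s : ℝ} (c : ℝ) (hρ : ρ ^ 2 = α₁ ^ 2 + α₂ ^ 2) (hρ0 : 0 < ρ)
    (hQ : (ρ - α₁) * s ^ 2 + 2 * α₂ * s + (ρ + α₁) ≠ 0) :
    c / (1 + ((α₂ * s ^ 2 + 2 * α₁ * s - α₂) / ((ρ - α₁) * s ^ 2 + 2 * α₂ * s + (ρ + α₁))) ^ 2) *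
      (2 * ρ / ((ρ - α₁) * s ^ 2 + 2 * α₂ * s + (ρ + α₁))) = c / (1 + s ^ 2) := by
  rw [rot_one_add_sq hρ hQ]
  set Q := (ρ - α₁) * s ^ 2 + 2 * α₂ * s + (ρ + α₁) with hQ_def
  have hs : (1 + s ^ 2) ≠ 0 := by positivity
  have h2 : (2 * ρ) ≠ 0 := by positivity
  field_simp

/-- The `s`-derivative of the rotation is `2ρ/Q`. [folklore] -/
theorem rot_deriv_val {ρ α₁ α₂ s : ℝ} (hρ : ρ ^ 2 = α₁ ^ 2 + α₂ ^ 2)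
    (hQ : (ρ - α₁) * s ^ 2 + 2 * α₂ * s + (ρ + α₁) ≠ 0) :
    ((2 * α₂ * s + 2 * α₁) * ((ρ - α₁) * s ^ 2 + 2 * α₂ * s + (ρ + α₁)) -
        (α₂ * s ^ 2 + 2 * α₁ * s - α₂) * (2 * (ρ - α₁) * s + 2 * α₂)) /
        ((ρ - α₁) * s ^ 2 + 2 * α₂ * s + (ρ + α₁)) ^ 2 =
      2 * ρ / ((ρ - α₁) * s ^ 2 + 2 * α₂ * s + (ρ + α₁)) := by
  rw [rot_wronskian ρ α₁ α₂ s hρ]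
  set Q := (ρ - α₁) * s ^ 2 + 2 * α₂ * s + (ρ + α₁) with hQ_def
  field_simp

/-- The inverse rotation's denominator at `m = P/Q` is `4ρ²/Q`. [folklore] -/
theorem rot_den_comp {ρ α₁ α₂ s : ℝ} (hρ : ρ ^ 2 = α₁ ^ 2 + α₂ ^ 2)
    (hQ : (ρ - α₁) * s ^ 2 + 2 * α₂ * s + (ρ + α₁) ≠ 0) :
    (ρ - α₁) * ((α₂ * s ^ 2 + 2 * α₁ * s - α₂) / ((ρ - α₁) * s ^ 2 + 2 * α₂ * s + (ρ + α₁))) ^ 2 +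
        2 * (-α₂) * ((α₂ * s ^ 2 + 2 * α₁ * s - α₂) / ((ρ - α₁) * s ^ 2 + 2 * α₂ * s + (ρ + α₁))) +
        (ρ + α₁) =
      4 * ρ ^ 2 / ((ρ - α₁) * s ^ 2 + 2 * α₂ * s + (ρ + α₁)) := by
  have h := rot_inv_den ρ α₁ α₂ s hρ
  set P := α₂ * s ^ 2 + 2 * α₁ * s - α₂ with hP
  set Q := (ρ - α₁) * s ^ 2 + 2 * α₂ * s + (ρ + α₁) with hQ_def
  field_simp
  linear_combination h

/-- The inverse rotation's numerator at `m = P/Q` is `4ρ² s/Q`. [folklore] -/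
theorem rot_num_comp' {ρ α₁ α₂ s : ℝ} (hρ : ρ ^ 2 = α₁ ^ 2 + α₂ ^ 2)
    (hQ : (ρ - α₁) * s ^ 2 + 2 * α₂ * s + (ρ + α₁) ≠ 0) :
    (-α₂) * ((α₂ * s ^ 2 + 2 * α₁ * s - α₂) / ((ρ - α₁) * s ^ 2 + 2 * α₂ * s + (ρ + α₁))) ^ 2 +
        2 * α₁ * ((α₂ * s ^ 2 + 2 * α₁ * s - α₂) / ((ρ - α₁) * s ^ 2 + 2 * α₂ * s + (ρ + α₁))) -
        (-α₂) = 4 * ρ ^ 2 * s / ((ρ - α₁) * s ^ 2 + 2 * α₂ * s + (ρ + α₁)) := by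
  have h := rot_inv_num ρ α₁ α₂ s hρ
  set P := α₂ * s ^ 2 + 2 * α₁ * s - α₂ with hP
  set Q := (ρ - α₁) * s ^ 2 + 2 * α₂ * s + (ρ + α₁) with hQ_def
  field_simp
  linear_combination h

/-- The inverse rotation undoes the rotation: `P̃(m)/Q̃(m) = s` at `m = P/Q`. [folklore] -/
theorem rot_num_comp {ρ α₁ α₂ s : ℝ} (hρ : ρ ^ 2 = α₁ ^ 2 + α₂ ^ 2) (hρ0 : 0 < ρ)
    (hQ : (ρ - α₁) * s ^ 2 + 2 * α₂ * s + (ρ + α₁) ≠ 0) :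
    ((-α₂) * ((α₂ * s ^ 2 + 2 * α₁ * s - α₂) / ((ρ - α₁) * s ^ 2 + 2 * α₂ * s + (ρ + α₁))) ^ 2 +
        2 * α₁ * ((α₂ * s ^ 2 + 2 * α₁ * s - α₂) / ((ρ - α₁) * s ^ 2 + 2 * α₂ * s + (ρ + α₁))) -
        (-α₂)) /
      ((ρ - α₁) * ((α₂ * s ^ 2 + 2 * α₁ * s - α₂) / ((ρ - α₁) * s ^ 2 + 2 * α₂ * s + (ρ + α₁))) ^ 2 +
        2 * (-α₂) * ((α₂ * s ^ 2 + 2 * α₁ * s - α₂) / ((ρ - α₁) * s ^ 2 + 2 * α₂ * s + (ρ + α₁))) +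
        (ρ + α₁)) = s := by
  rw [rot_den_comp hρ hQ, rot_num_comp' hρ hQ]
  set Q := (ρ - α₁) * s ^ 2 + 2 * α₂ * s + (ρ + α₁) with hQ_def
  have h4 : 4 * ρ ^ 2 ≠ 0 := by positivity
  field_simp

/-! ### Semialgebraicity of the weight and of the two distance functions -/

/-- The weight `h(x)/(1 + s²)` is `ℚ`-semialgebraic over the base. [BCR 1998, Prop. 2.2.6]
[folklore] -/
theorem isSemialgebraicFunOn_weight {B : Set (Fin n → ℝ)} {h : (Fin n → ℝ) → ℝ}
    (hh : IsSemialgebraicFunOn ℚ B h) {D : Set (Fin (n + 1) → ℝ)} (hD : IsSemialgebraic ℚ D)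
    (hDB : D ⊆ {b | Fin.init b ∈ B}) :
    IsSemialgebraicFunOn ℚ D (fun b => h (Fin.init b) / (1 + b (Fin.last n) ^ 2)) := by
  have hs := isSemialgebraicFunOn_apply hD (Fin.last n)
  refine IsSemialgebraicFunOn.div (hh.comp_init.mono hDB hD)
    ((IsSemialgebraicFunOn.add_holds (isSemialgebraicFunOn_ratCast hD 1)
      (IsSemialgebraicFunOn.mul_holds hs hs)).congr fun b _ => by simp [sq]) fun b _ => by positivity

/-- `W_ρ(x, s) = ((1 − ρ)² + (1 + ρ)² s²)/(1 + s²)` is `ℚ`-semialgebraic over the base for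
`ℚ`-semialgebraic `ρ`. [BCR 1998, Prop. 2.2.6] [folklore] -/
theorem isSemialgebraicFunOn_Wreal {B : Set (Fin n → ℝ)} {ρ : (Fin n → ℝ) → ℝ}
    (hρ : IsSemialgebraicFunOn ℚ B ρ) {D : Set (Fin (n + 1) → ℝ)} (hD : IsSemialgebraic ℚ D)
    (hDB : D ⊆ {b | Fin.init b ∈ B}) :
    IsSemialgebraicFunOn ℚ D (fun b => ((1 - ρ (Fin.init b)) ^ 2 +
      (1 + ρ (Fin.init b)) ^ 2 * b (Fin.last n) ^ 2) / (1 + b (Fin.last n) ^ 2)) := by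
  have hs := isSemialgebraicFunOn_apply hD (Fin.last n)
  have hr := hρ.comp_init.mono hDB hD
  have h1 := isSemialgebraicFunOn_ratCast hD 1
  have hnum : IsSemialgebraicFunOn ℚ D (fun b => (1 - ρ (Fin.init b)) ^ 2 +
      (1 + ρ (Fin.init b)) ^ 2 * b (Fin.last n) ^ 2) := by
    have ha := IsSemialgebraicFunOn.sub_holds h1 hr
    have hb := IsSemialgebraicFunOn.add_holds h1 hr
    exact (IsSemialgebraicFunOn.add_holds (IsSemialgebraicFunOn.mul_holds ha ha)
      (IsSemialgebraicFunOn.mul_holds (IsSemialgebraicFunOn.mul_holds hb hb)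
        (IsSemialgebraicFunOn.mul_holds hs hs))).congr fun b _ => by simp [sq]
  exact IsSemialgebraicFunOn.div hnum ((IsSemialgebraicFunOn.add_holds h1
    (IsSemialgebraicFunOn.mul_holds hs hs)).congr fun b _ => by simp [sq]) fun b _ => by positivity

/-- `W_α(x, s) = ((1−s²)/(1+s²) − α₁)² + (2s/(1+s²) − α₂)²` is `ℚ`-semialgebraic over the base.
[BCR 1998, Prop. 2.2.6] [folklore] -/
theorem isSemialgebraicFunOn_Walpha {B : Set (Fin n → ℝ)} {α₁ α₂ : (Fin n → ℝ) → ℝ}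
    (hα₁ : IsSemialgebraicFunOn ℚ B α₁) (hα₂ : IsSemialgebraicFunOn ℚ B α₂)
    {D : Set (Fin (n + 1) → ℝ)} (hD : IsSemialgebraic ℚ D) (hDB : D ⊆ {b | Fin.init b ∈ B}) :
    IsSemialgebraicFunOn ℚ D (fun b =>
      ((1 - b (Fin.last n) ^ 2) / (1 + b (Fin.last n) ^ 2) - α₁ (Fin.init b)) ^ 2 +
        (2 * b (Fin.last n) / (1 + b (Fin.last n) ^ 2) - α₂ (Fin.init b)) ^ 2) := by
  have hs := isSemialgebraicFunOn_apply hD (Fin.last n)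
  have ha₁ := hα₁.comp_init.mono hDB hD
  have ha₂ := hα₂.comp_init.mono hDB hD
  have h1 := isSemialgebraicFunOn_ratCast hD 1
  have h2 := isSemialgebraicFunOn_ratCast hD 2
  have hden : IsSemialgebraicFunOn ℚ D (fun b => 1 + b (Fin.last n) ^ 2) :=
    (IsSemialgebraicFunOn.add_holds h1 (IsSemialgebraicFunOn.mul_holds hs hs)).congr fun b _ => by simp [sq]
  have hden0 : ∀ b ∈ D, 1 + b (Fin.last n) ^ 2 ≠ 0 := fun b _ => by positivity
  have hc : IsSemialgebraicFunOn ℚ D (fun b => (1 - b (Fin.last n) ^ 2) / (1 + b (Fin.last n) ^ 2)) :=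
    IsSemialgebraicFunOn.div ((IsSemialgebraicFunOn.sub_holds h1
      (IsSemialgebraicFunOn.mul_holds hs hs)).congr fun b _ => by simp [sq]) hden hden0
  have hsn : IsSemialgebraicFunOn ℚ D (fun b => 2 * b (Fin.last n) / (1 + b (Fin.last n) ^ 2)) :=
    IsSemialgebraicFunOn.div ((IsSemialgebraicFunOn.mul_holds h2 hs).congr fun b _ => by simp) hden hden0
  have hu := IsSemialgebraicFunOn.sub_holds hc ha₁
  have hv := IsSemialgebraicFunOn.sub_holds hsn ha₂
  exact (IsSemialgebraicFunOn.add_holds (IsSemialgebraicFunOn.mul_holds hu hu)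
    (IsSemialgebraicFunOn.mul_holds hv hv)).congr fun b _ => by simp [sq]

end Summit.KontsevichZagierPeriods.K2SymbolChains.JensenIsScissorsProof
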